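import Mathlib.AlgebraicGeometry.Morphisms.Separated
import Mathlib.CategoryTheory.Monoidal.Cartesian.Over
import Literature.AlgebraicGeometry.Modules.ModuleCechComplex
import HarnessLib

/-!
# The product affine cover `(U_i ×_k V_j)` of `X ×_k Y` and the triple cover `(W₀_c ∩ g⁻¹ T_l)` (Čech bookkeeping for Künneth ∕ `m^*`)

Layer `Literature/AlgebraicGeometry/Morphisms` (THEOREMS only; no definition — the covers are CHARACTERISED by their
shapes and consumers `obtain` them once); cell `hodgecm-mathlib`, F-11 sub-line P1b, brick (G5-a) «product-cover
bookkeeping» (B-p21 (g21); letter F0P1b-p02 (g2) `LETTER-G5-ProductCover.v0`; the index maps and their admissibility are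
the sibling ★ `AbelianSchemes/AbelianSchemeProductCoverIndexMaps`, whose binders `hW₀`∕`hW` take exactly the shapes below).

For `X Y : Over (Spec k)` with affine opens `U i ⊆ X`, `V j ⊆ Y` (index types `ι`, `ι'`; consumers order `ι ×ₗ ι'`
lexicographically, as the ordered Čech dialect ★ `Algebra/Homology/OrderedCechSystem*` wants):
* §1 `isAffineOpen_fst_inf_snd` — `p₁⁻¹ U_i ∩ p₂⁻¹ V_j = U_i ×_k V_j` is AFFINE (range of the open immersion from the fibre
  product of affine schemes over the affine base; Mathlib `Scheme.Pullback.range_map`); **`exists_productCover`** —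
  `∃ W₀ : ι ×ₗ ι' → (X ⊗ Y).left.affineOpens, (W₀ (i, j)).1 = p₁⁻¹ U_i ⊓ p₂⁻¹ V_j`; `productCover_eq`;
  **`iSup_productCover_eq_top`** (it covers when `U`, `V` cover); `isSeparated_tensorObj_left` (`X ×_k Y` is separated when
  `X → Spec k`, `Y → Spec k` are);
* `isAffineOpen_cechOpen_of_nonempty` — on a separated scheme every NON-EMPTY finite intersection of a family of affine opens
  is affine (the Leray hypothesis for ★ `Modules.cechComplex`), for `U`, `W₀`, `W` alike;
* §2 `isAffineOpen_inf_preimage` — for `g : S ⟶ Z` with `Z → Spec k` SEPARATED, `W ∩ g⁻¹ T` is affine for affine `W ⊆ S`,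
  `T ⊆ Z` (`W ↪ S → Z` is an affine morphism: Mathlib `IsAffineHom.of_comp`); **`exists_tripleCover`** —
  `∃ W : (ι ×ₗ ι') ×ₗ ι'' → S.affineOpens, (W (c, l)).1 = (W₀ c).1 ⊓ g⁻¹ (T l).1` (for `g = m` the group law of an abelian
  scheme this is the cover on which `m^*` is read); `tripleCover_eq`; **`iSup_tripleCover_eq_top`**.

HC_CM is proved only modulo the 7 printed citations until rung 0 closes — nothing here bears on a summit statement.

## References
* [GortzWedhorn2020] U. Görtz, T. Wedhorn, *Algebraic Geometry I*, 2nd ed. (2020): Prop. 4.20 (fibre products of affine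
  schemes), Prop. 9.13 and Prop. 12.3 (separated and affine morphisms).
* [GortzWedhorn2023] U. Görtz, T. Wedhorn, *Algebraic Geometry II* (2023): Def. 21.68 and Thm. 22.9 (Čech cohomology on an
  affine cover with affine intersections).
* [StacksProject] The Stacks Project, Tag 01JO (fibre products of schemes, affine case), Tag 01FG (Čech complex and
  refinements), Tag 01SG (affine morphisms).
* [Hartshorne1977] R. Hartshorne, *Algebraic Geometry*, GTM 52 (1977): II Ex. 4.3 (intersections of affines in a separated scheme).
-/

noncomputable section

-- `TopCat.Presheaf`/`TopCat.Sheaf` are not reducible (as in Mathlib's `AlgebraicGeometry/Modules`).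
set_option backward.isDefEq.respectTransparency false

open CategoryTheory AlgebraicGeometry Opposite TopologicalSpace Limits MonoidalCategory

universe u

namespace Literature.AlgebraicGeometry.Morphisms

open Literature.AlgebraicGeometry.Modules

/-! ## §1 The product cover of `X ×_k Y` -/

section Product

variable {k : Type u} [CommRing k] (X Y : Over (Spec (CommRingCat.of k)))
  {ι ι' : Type} (U : ι → X.left.affineOpens) (V : ι' → Y.left.affineOpens)

/-- **`U_i ×_k V_j = p₁⁻¹ U_i ∩ p₂⁻¹ V_j` is an affine open of `X ×_k Y`** (it is the range of the open immersion
`U_i ×_k V_j → X ×_k Y`, a fibre product of affine schemes over the affine base).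
[cite: GortzWedhorn2020, Prop. 4.20 (products of affine schemes)] [cite: StacksProject, Tag 01JO] -/
theorem isAffineOpen_fst_inf_snd (i : ι) (j : ι') :
    IsAffineOpen ((CartesianMonoidalCategory.fst X Y).left ⁻¹ᵁ (U i).1 ⊓
      (CartesianMonoidalCategory.snd X Y).left ⁻¹ᵁ (V j).1) := by
  haveI : IsAffine (U i).1 := (U i).2
  haveI : IsAffine (V j).1 := (V j).2
  let p : pullback ((U i).1.ι ≫ X.hom) ((V j).1.ι ≫ Y.hom) ⟶ pullback X.hom Y.hom :=
    pullback.map _ _ _ _ (U i).1.ι (V j).1.ι (𝟙 _) (Category.comp_id _) (Category.comp_id _)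
  have hr : Set.range p = (pullback.fst X.hom Y.hom) ⁻¹' ((U i).1 : Set X.left) ∩
      (pullback.snd X.hom Y.hom) ⁻¹' ((V j).1 : Set Y.left) := by
    rw [Scheme.Pullback.range_map, Scheme.Opens.range_ι, Scheme.Opens.range_ι]
  have h := isAffineOpen_opensRange p
  have e : p.opensRange = (CartesianMonoidalCategory.fst X Y).left ⁻¹ᵁ (U i).1 ⊓
      (CartesianMonoidalCategory.snd X Y).left ⁻¹ᵁ (V j).1 := by
    apply TopologicalSpace.Opens.ext
    rw [Scheme.Hom.coe_opensRange, hr]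
    rfl
  rw [← e]
  exact h

/-- **THE PRODUCT COVER exists as a family of affine opens** indexed by the lexicographic product `ι ×ₗ ι'`:
`W₀ (i, j) = p₁⁻¹ U_i ∩ p₂⁻¹ V_j`. (Characterised, not constructed: consumers `obtain` it once.)
[cite: GortzWedhorn2020, Prop. 4.20] [cite: StacksProject, Tag 01JO] -/
theorem exists_productCover :
    ∃ W₀ : ι ×ₗ ι' → (X ⊗ Y).left.affineOpens, ∀ i j, (W₀ (toLex (i, j))).1 =
      (CartesianMonoidalCategory.fst X Y).left ⁻¹ᵁ (U i).1 ⊓ (CartesianMonoidalCategory.snd X Y).left ⁻¹ᵁ (V j).1 :=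
  ⟨fun c => ⟨_, isAffineOpen_fst_inf_snd X Y U V (ofLex c).1 (ofLex c).2⟩, fun _ _ => rfl⟩

variable {X Y U V} (W₀ : ι ×ₗ ι' → (X ⊗ Y).left.affineOpens)
  (hW₀ : ∀ i j, (W₀ (toLex (i, j))).1 =
    (CartesianMonoidalCategory.fst X Y).left ⁻¹ᵁ (U i).1 ⊓ (CartesianMonoidalCategory.snd X Y).left ⁻¹ᵁ (V j).1)

include hW₀ in
/-- The product cover read on a general index `c : ι ×ₗ ι'`. [cite: StacksProject, Tag 01JO] -/
theorem productCover_eq (c : ι ×ₗ ι') : (W₀ c).1 =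
    (CartesianMonoidalCategory.fst X Y).left ⁻¹ᵁ (U (ofLex c).1).1 ⊓
      (CartesianMonoidalCategory.snd X Y).left ⁻¹ᵁ (V (ofLex c).2).1 := by
  rw [← hW₀]
  rfl

include hW₀ in
/-- **The product cover COVERS** when `U` covers `X` and `V` covers `Y`. [cite: StacksProject, Tag 01JO] -/
theorem iSup_productCover_eq_top (hU : ⨆ i, (U i).1 = ⊤) (hV : ⨆ j, (V j).1 = ⊤) : ⨆ c, (W₀ c).1 = ⊤ := by
  refine top_le_iff.mp fun z _ => ?_
  have hz₁ : (CartesianMonoidalCategory.fst X Y).left z ∈ (⊤ : X.left.Opens) := trivial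
  have hz₂ : (CartesianMonoidalCategory.snd X Y).left z ∈ (⊤ : Y.left.Opens) := trivial
  rw [← hU] at hz₁
  rw [← hV] at hz₂
  obtain ⟨i, hi⟩ := Opens.mem_iSup.mp hz₁
  obtain ⟨j, hj⟩ := Opens.mem_iSup.mp hz₂
  exact Opens.mem_iSup.mpr ⟨toLex (i, j), by rw [hW₀]; exact ⟨hi, hj⟩⟩

/-! ### Separatedness: all non-empty finite intersections of the product cover are affine -/

/-- `X ×_k Y` is a separated scheme when `X → Spec k` and `Y → Spec k` are separated morphisms.
[cite: GortzWedhorn2020, Prop. 9.13 (separatedness is stable under base change and composition)] -/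
theorem isSeparated_tensorObj_left [IsSeparated X.hom] [IsSeparated Y.hom] : (X ⊗ Y).left.IsSeparated := by
  have h : IsSeparated (X ⊗ Y).hom := by
    rw [Over.tensorObj_hom]
    infer_instance
  constructor
  rw [← terminal.comp_from (X ⊗ Y).hom]
  infer_instance

end Product

/-! ### Separated schemes: every non-empty finite intersection of a family of affine opens is affine -/

section CechOpen

/-- **Every non-empty finite intersection `W_s = ⋂_{c ∈ s} W_c` of a family of affine opens of a SEPARATED scheme is
affine** (Mathlib `IsAffineOpen.inf`; stated for ★ `Modules.cechOpen`, the opens of the ordered module Čech complex) — the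
hypothesis of ordered-Čech Leray for the covers `U`, `W₀`, `W`. [cite: GortzWedhorn2023, Def. 21.68 and Thm. 22.9] -/
theorem isAffineOpen_cechOpen_of_nonempty {S : Scheme.{u}} [S.IsSeparated] {J : Type} (W : J → S.affineOpens)
    {s : Finset J} (hs : s.Nonempty) : IsAffineOpen (cechOpen (fun c => (W c).1) s) := by
  classical
  induction s using Finset.induction_on with
  | empty => exact absurd hs Finset.not_nonempty_empty
  | insert a s ha ih =>
    unfold cechOpen at ih ⊢
    rw [Finset.inf_insert]
    by_cases hs' : s.Nonempty
    · exact (W a).2.inf (ih hs')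
    · rw [Finset.not_nonempty_iff_eq_empty.mp hs', Finset.inf_empty, inf_top_eq]
      exact (W a).2

end CechOpen


/-! ## §2 Meeting the product cover with the preimage of an affine cover along a second map (the triple cover) -/

section Triple

variable {k : Type u} [CommRing k] {S : Scheme.{u}} {Z : Over (Spec (CommRingCat.of k))}

/-- **An affine open met with the preimage of an affine open along a map to a SEPARATED `k`-scheme is affine**:
for `g : S ⟶ Z` with `Z → Spec k` separated, `W ⊆ S` affine and `T ⊆ Z` affine, `W ∩ g⁻¹ T` is affine
(`W ↪ S → Z` is an affine morphism, being followed by the separated `Z → Spec k` into an affine morphism).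
[cite: GortzWedhorn2020, Prop. 12.3 and Prop. 9.21] [cite: StacksProject, Tag 01SG] -/
theorem isAffineOpen_inf_preimage [IsSeparated Z.hom] (g : S ⟶ Z.left) {W : S.Opens} (hW : IsAffineOpen W)
    (T : Z.left.affineOpens) : IsAffineOpen (W ⊓ g ⁻¹ᵁ T.1) := by
  haveI : IsAffine W := hW
  haveI : IsAffineHom (W.ι ≫ g) := IsAffineHom.of_comp (W.ι ≫ g) Z.hom
  have h1 : IsAffineOpen ((W.ι ≫ g) ⁻¹ᵁ T.1) := T.2.preimage (W.ι ≫ g)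
  have h2 := h1.image_of_isOpenImmersion W.ι
  rw [Scheme.Hom.comp_preimage, Scheme.Hom.image_preimage_eq_opensRange_inf, Scheme.Opens.opensRange_ι] at h2
  exact h2

variable {ι ι' ι'' : Type} (W₀ : ι ×ₗ ι' → S.affineOpens) (g : S ⟶ Z.left) (T : ι'' → Z.left.affineOpens)

/-- **THE TRIPLE COVER exists**: affine opens `W (c, l) = W₀ c ∩ g⁻¹ T_l` indexed by `(ι ×ₗ ι') ×ₗ ι''`
(for `S = X ×_k X`, `g = m` the group law and `T = U`: the cover on which `m^*` is read).
[cite: StacksProject, Tag 01FG] [cite: GortzWedhorn2023, Def. 21.68] -/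
theorem exists_tripleCover [IsSeparated Z.hom] :
    ∃ W : (ι ×ₗ ι') ×ₗ ι'' → S.affineOpens, ∀ c l, (W (toLex (c, l))).1 = (W₀ c).1 ⊓ g ⁻¹ᵁ (T l).1 :=
  ⟨fun d => ⟨_, isAffineOpen_inf_preimage g (W₀ (ofLex d).1).2 (T (ofLex d).2)⟩, fun _ _ => rfl⟩

variable (W : (ι ×ₗ ι') ×ₗ ι'' → S.affineOpens) (hW : ∀ c l, (W (toLex (c, l))).1 = (W₀ c).1 ⊓ g ⁻¹ᵁ (T l).1)

include hW in
/-- The triple cover read on a general index. [cite: StacksProject, Tag 01FG] -/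
theorem tripleCover_eq (d : (ι ×ₗ ι') ×ₗ ι'') : (W d).1 = (W₀ (ofLex d).1).1 ⊓ g ⁻¹ᵁ (T (ofLex d).2).1 := by
  rw [← hW]
  rfl

include hW in
/-- **The triple cover COVERS** when `W₀` covers `S` and `T` covers `Z`. [cite: StacksProject, Tag 01FG] -/
theorem iSup_tripleCover_eq_top (hW₀ : ⨆ c, (W₀ c).1 = ⊤) (hT : ⨆ l, (T l).1 = ⊤) : ⨆ d, (W d).1 = ⊤ := by
  refine top_le_iff.mp fun z _ => ?_
  have hz₁ : z ∈ (⊤ : S.Opens) := trivial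
  have hz₂ : g z ∈ (⊤ : Z.left.Opens) := trivial
  rw [← hW₀] at hz₁
  rw [← hT] at hz₂
  obtain ⟨c, hc⟩ := Opens.mem_iSup.mp hz₁
  obtain ⟨l, hl⟩ := Opens.mem_iSup.mp hz₂
  exact Opens.mem_iSup.mpr ⟨toLex (c, l), by rw [hW]; exact ⟨hc, hl⟩⟩

end Triple

end Literature.AlgebraicGeometry.Morphisms

end
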